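import Summits.Parity.GeneralizedHardyLittlewood.Theorems.PrimeLevelFamEdgeMomentsBeyondDiagonalLayersClassBound
import Summits.Parity.GeneralizedHardyLittlewood.Theorems.PrimeLevelFamEdgeMomentsBeyondDiagonalLayersClassPascadiAll
import HarnessLib

/-!
# Route `PrimeLevelFamEdge`, crux K_A `MomentsBeyondDiagonal` (stmt-Parity-20007), line «petersson_layers» v4:
# the per-class bound of `stub_farP`'s `k = 0` forms in closed form for EVERY layer `r` (assembly step E6, CONDITIONAL on
# Pascadi's Thm 7.1)

`…LayersClassBound` without the hypothesis `q ∤ r` (so that the layers `q ∣ r` at the top of the print band are covered), through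
`…LayersClassPascadiAll` (proofs verbatim): **`norm_classForm_le_of_pascadi_all`** / **`norm_classForm_le_of_pascadi_all'`**.
Remaining (census E5b/E7): the sums over classes and blocks with the exponent bookkeeping and the final instantiation of
`subFar_rhoP_of_form_bound_zero`; NOT done here.  Proof only (def-free, CONDITIONAL helper: the named fact is a HYPOTHESIS); K_A NOT
proved; nothing of Pascadi's proof is formalised; nothing about Landau–Siegel zeros.
-/

noncomputable section

open scoped Real Nat
open Complex Finset Polynomial MeasureTheory
open Literature.NumberTheory.LFunctions

namespace Summit.Parity.GeneralizedHardyLittlewood.Theorems.MomentsBeyondDiagonal.Layers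

open Summit.Parity.GeneralizedHardyLittlewood.Theorems.PrimeLevelFamEdgeIdeaDeltas.PeterssonLayers

/-- **The per-class bound, ordering `σ₂'V ≤ σ₁'Z₁Z₂ ≤ qr/g`** (CONDITIONAL on `pascadi2025_theorem71`; `q ≥ 64` prime, ANY `r`,
class `(s₁,t₁,s₂,t₂)` with `q ∤ s₁ * t₁`, `g = ((s₁t₁,s₂t₂),qr)`; divisor bounds `D₁, D₂` as hypotheses).
[cite: Pascadi2025, Thm. 7.1 (case c = q·(r/g), a = 1)] -/
theorem norm_classForm_le_of_pascadi_all (h : pascadi2025_theorem71) {ε : ℝ} (hε : 0 < ε) :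
    ∃ C : ℝ, 0 ≤ C ∧ ∀ (q : ℕ) [NeZero q], 64 ≤ q → q.Prime → ∀ (r : ℕ),
      ∀ (P : ℝ[X]) (B : ℝ), (∀ t ∈ Set.Icc (0 : ℝ) 1, |P.eval t| ≤ B) → ∀ (Δ' : ℝ), 0 < Δ' →
      ∀ (i j : ℕ) (K : ℝ), 0 ≤ K →
        (∀ {N₁ N₂ : ℕ}, N₁ ∈ afeBox q → N₂ ∈ afeBox q →
          ‖((((N₁ : ℝ) * N₂) ^ (-(1 / 2 : ℝ)) : ℝ) : ℂ) * afeW (KMV2000.qhat q) i j N₁ N₂‖ *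
              Real.sqrt ((N₁ : ℝ) * N₂) ≤
            K * ((1 + Real.log (KMV2000.qhat q)) * (1 + 2 * Real.log q)) ^ (i + j) *
              (KMV2000.qhat q ^ 2 / ((N₁ : ℝ) * N₂)) ^ (0 : ℝ)) →
      ∀ (Y d₁ d₂ s₁ t₁ s₂ t₂ g : ℕ) [NeZero (q * r / g)],
        1 ≤ d₁ → 1 ≤ d₂ → 1 ≤ s₁ → 1 ≤ s₂ → 1 ≤ t₁ → 1 ≤ t₂ →
        g = Nat.gcd (Nat.gcd (s₁ * t₁) (s₂ * t₂)) (q * r) → ¬ q ∣ s₁ * t₁ →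
        1 ≤ s₂ * t₂ / g * (Y / (d₁ * t₁ * (d₂ * t₂))) → s₂ * t₂ / g * (Y / (d₁ * t₁ * (d₂ * t₂))) ≤ s₁ * t₁ / g * ((⌊KMV2000.qhat q ^ Δ'⌋₊ / d₁ / s₁) * (⌊KMV2000.qhat q ^ Δ'⌋₊ / d₂ / s₂)) →
        s₁ * t₁ / g * ((⌊KMV2000.qhat q ^ Δ'⌋₊ / d₁ / s₁) * (⌊KMV2000.qhat q ^ Δ'⌋₊ / d₂ / s₂)) ≤ q * r / g →
        Y / (d₁ * t₁ * (d₂ * t₂)) ≤ (q ^ 2 / d₁ / t₁) * (q ^ 2 / d₂ / t₂) →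
      ∀ (D₁ D₂ : ℝ), 0 ≤ D₁ → 0 ≤ D₂ →
        (∀ u ∈ Icc 1 ((⌊KMV2000.qhat q ^ Δ'⌋₊ / d₁ / s₁) * (⌊KMV2000.qhat q ^ Δ'⌋₊ / d₂ / s₂)), (#u.divisors : ℝ) ≤ D₁) →
        (∀ v ∈ Icc 1 ((q ^ 2 / d₁ / t₁) * (q ^ 2 / d₂ / t₂)), (#v.divisors : ℝ) ≤ D₂) →
        ‖∑ f₁ ∈ Icc 1 (⌊KMV2000.qhat q ^ Δ'⌋₊ / d₁ / s₁), ∑ h₁ ∈ Icc 1 (q ^ 2 / d₁ / t₁),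
          ∑ f₂ ∈ Icc 1 (⌊KMV2000.qhat q ^ Δ'⌋₊ / d₂ / s₂), ∑ h₂ ∈ Icc 1 (q ^ 2 / d₂ / t₂),
            (if Nat.Coprime f₁ (q * r) ∧ Nat.Coprime f₂ (q * r) then
                (KMV2000.mollifierCoeff P (KMV2000.qhat q ^ Δ') (d₁ * (s₁ * f₁)) : ℂ) *
                  (KMV2000.mollifierCoeff P (KMV2000.qhat q ^ Δ') (d₂ * (s₂ * f₂)) : ℂ) *
                  ((Real.sqrt ((s₁ * f₁ : ℕ) : ℝ) * Real.sqrt ((s₂ * f₂ : ℕ) : ℝ) : ℝ) : ℂ) else 0) *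
              (if Nat.Coprime h₁ (q * r) ∧ Nat.Coprime h₂ (q * r) then
                  (if d₁ * (t₁ * h₁) * (d₂ * (t₂ * h₂)) ≤ Y then
                      ((((((d₁ * (t₁ * h₁) : ℕ) : ℝ) * ((d₂ * (t₂ * h₂) : ℕ) : ℝ)) ^ (-(1 / 2 : ℝ)) : ℝ) : ℂ) *
                        afeW (KMV2000.qhat q) i j (d₁ * (t₁ * h₁)) (d₂ * (t₂ * h₂))) else 0) *
                    ((Real.sqrt ((t₁ * h₁ : ℕ) : ℝ) * Real.sqrt ((t₂ * h₂ : ℕ) : ℝ) : ℝ) : ℂ) else 0) *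
              kloostermanSum (q * r / g) ((s₁ * t₁ / g * (f₁ * f₂) : ℕ) : ZMod (q * r / g))
                ((s₂ * t₂ / g * (h₁ * h₂) : ℕ) : ZMod (q * r / g))‖ ≤
          C * Real.sqrt D₁ * Real.sqrt D₂ *
            (B ^ 2 * Real.sqrt (((⌊KMV2000.qhat q ^ Δ'⌋₊ / d₁ / s₁ : ℕ) : ℝ) * ((⌊KMV2000.qhat q ^ Δ'⌋₊ / d₂ / s₂ : ℕ) : ℝ))) *
            (K * ((1 + Real.log (KMV2000.qhat q)) * (1 + 2 * Real.log q)) ^ (i + j) *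
              Real.sqrt ((1 + 2 * Real.log q) * ((Y : ℝ) / (((d₁ * t₁ : ℕ) : ℝ) * ((d₂ * t₂ : ℕ) : ℝ))))) *
            ((q * r / g : ℕ) : ℝ) ^ (1 + ε) *
            (Pascadi2025.bracket71 (s₁ * t₁ / g * ((⌊KMV2000.qhat q ^ Δ'⌋₊ / d₁ / s₁) * (⌊KMV2000.qhat q ^ Δ'⌋₊ / d₂ / s₂)) : ℕ) (s₂ * t₂ / g * (Y / (d₁ * t₁ * (d₂ * t₂))) : ℕ) ((q * r / g : ℕ) : ℝ) (r / g : ℕ) (r / g : ℕ)) ^ (1 / 6 : ℝ) := by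
  obtain ⟨C, hC0, hC⟩ := norm_sum_four_le_of_pascadi_hyperbolic_all h hε
  refine ⟨C, hC0, ?_⟩
  intro q _ h64 hq r P B hB Δ' hΔ' i j K hK0 hK Y d₁ d₂ s₁ t₁ s₂ t₂ g _ hd₁ hd₂ hs₁ hs₂ ht₁ ht₂ hg hσ
    hN hNM hMc hV D₁ D₂ hD₁0 hD₂0 hD₁ hD₂
  have hqr0 : q * r ≠ 0 := by
    intro h0
    exact NeZero.ne (q * r / g) (by rw [h0, Nat.zero_div])
  -- the class modulus `q r / g = q · (r/g)`, `q ∤ r/g`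
  obtain ⟨-, hcg⟩ := classGcd_dvd_right (r := r) (σ₂ := s₂ * t₂) hq hσ
  rw [← hg] at hcg
  -- the dilations are positive
  have hgpos : 0 < g := by rw [hg]; exact Nat.pos_of_ne_zero (Nat.gcd_ne_zero_right hqr0)
  have hgσ₁ : g ∣ s₁ * t₁ := by rw [hg]; exact (classGcd_dvd (s₁ * t₁) (s₂ * t₂) (q * r)).1
  have hgσ₂ : g ∣ s₂ * t₂ := by rw [hg]; exact (classGcd_dvd (s₁ * t₁) (s₂ * t₂) (q * r)).2.1
  have hσ₁pos : 0 < s₁ * t₁ / g :=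
    Nat.div_pos (Nat.le_of_dvd (Nat.mul_pos hs₁ ht₁) hgσ₁) hgpos
  have hσ₂pos : 0 < s₂ * t₂ / g :=
    Nat.div_pos (Nat.le_of_dvd (Nat.mul_pos hs₂ ht₂) hgσ₂) hgpos
  -- support and coprimality of the class coefficients
  have hD : 0 < d₁ * t₁ * (d₂ * t₂) := by positivity
  have hBsupp : ∀ n₁ n₂ : ℕ, Y / (d₁ * t₁ * (d₂ * t₂)) < n₁ * n₂ →
      (if Nat.Coprime n₁ (q * r) ∧ Nat.Coprime n₂ (q * r) then
          (if d₁ * (t₁ * n₁) * (d₂ * (t₂ * n₂)) ≤ Y then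
              ((((((d₁ * (t₁ * n₁) : ℕ) : ℝ) * ((d₂ * (t₂ * n₂) : ℕ) : ℝ)) ^ (-(1 / 2 : ℝ)) : ℝ) : ℂ) *
                afeW (KMV2000.qhat q) i j (d₁ * (t₁ * n₁)) (d₂ * (t₂ * n₂))) else 0) *
            ((Real.sqrt ((t₁ * n₁ : ℕ) : ℝ) * Real.sqrt ((t₂ * n₂ : ℕ) : ℝ) : ℝ) : ℂ) else 0) = 0 :=
    fun n₁ n₂ hlt ↦ classAFE_eq_zero_of_lt hD
      (fun N₁ N₂ ↦ ((((N₁ : ℝ) * (N₂ : ℝ)) ^ (-(1 / 2 : ℝ)) : ℝ) : ℂ) * afeW (KMV2000.qhat q) i j N₁ N₂)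
      (q * r) (fun n₁ n₂ ↦ ((Real.sqrt ((t₁ * n₁ : ℕ) : ℝ) * Real.sqrt ((t₂ * n₂ : ℕ) : ℝ) : ℝ) : ℂ)) hlt
  have hsupp : ∀ f₁ ∈ Icc 1 (⌊KMV2000.qhat q ^ Δ'⌋₊ / d₁ / s₁), ∀ f₂ ∈ Icc 1 (⌊KMV2000.qhat q ^ Δ'⌋₊ / d₂ / s₂),
      ∀ h₁ ∈ Icc 1 (q ^ 2 / d₁ / t₁), ∀ h₂ ∈ Icc 1 (q ^ 2 / d₂ / t₂),
      (if Nat.Coprime f₁ (q * r) ∧ Nat.Coprime f₂ (q * r) then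
          (KMV2000.mollifierCoeff P (KMV2000.qhat q ^ Δ') (d₁ * (s₁ * f₁)) : ℂ) *
            (KMV2000.mollifierCoeff P (KMV2000.qhat q ^ Δ') (d₂ * (s₂ * f₂)) : ℂ) *
            ((Real.sqrt ((s₁ * f₁ : ℕ) : ℝ) * Real.sqrt ((s₂ * f₂ : ℕ) : ℝ) : ℝ) : ℂ) else 0) *
        (if Nat.Coprime h₁ (q * r) ∧ Nat.Coprime h₂ (q * r) then
            (if d₁ * (t₁ * h₁) * (d₂ * (t₂ * h₂)) ≤ Y then
                ((((((d₁ * (t₁ * h₁) : ℕ) : ℝ) * ((d₂ * (t₂ * h₂) : ℕ) : ℝ)) ^ (-(1 / 2 : ℝ)) : ℝ) : ℂ) *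
                  afeW (KMV2000.qhat q) i j (d₁ * (t₁ * h₁)) (d₂ * (t₂ * h₂))) else 0) *
              ((Real.sqrt ((t₁ * h₁ : ℕ) : ℝ) * Real.sqrt ((t₂ * h₂ : ℕ) : ℝ) : ℝ) : ℂ) else 0) ≠ 0 →
      Nat.Coprime (Nat.gcd (s₁ * t₁ / g * (f₁ * f₂)) (s₂ * t₂ / g * (h₁ * h₂))) (q * r / g) := by
    intro f₁ _ f₂ _ h₁ _ h₂ _ hne
    have key := coprime_of_classCoeff_ne_zero hqr0 s₁ t₁ s₂ t₂
      (fun m₁ m₂ ↦ (KMV2000.mollifierCoeff P (KMV2000.qhat q ^ Δ') (d₁ * m₁) : ℂ) *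
        (KMV2000.mollifierCoeff P (KMV2000.qhat q ^ Δ') (d₂ * m₂) : ℂ) * ((Real.sqrt (m₁ : ℝ) * Real.sqrt (m₂ : ℝ) : ℝ) : ℂ))
      (fun n₁ n₂ ↦ (if d₁ * n₁ * (d₂ * n₂) ≤ Y then
          (((((((d₁ * n₁ : ℕ)) : ℝ) * ((d₂ * n₂ : ℕ) : ℝ)) ^ (-(1 / 2 : ℝ)) : ℝ) : ℂ) *
            afeW (KMV2000.qhat q) i j (d₁ * n₁) (d₂ * n₂)) else 0) *
          ((Real.sqrt (n₁ : ℝ) * Real.sqrt (n₂ : ℝ) : ℝ) : ℂ))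
      (f₁ := f₁) (h₁ := h₁) (f₂ := f₂) (h₂ := h₂) hne
    rw [← hg] at key
    exact key
  -- the per-class Pascadi inequality on the hyperbolic box
  have main := hC (q * r / g) q (r / g) hcg hq (s₁ * t₁ / g) (s₂ * t₂ / g)
    (⌊KMV2000.qhat q ^ Δ'⌋₊ / d₁ / s₁) (⌊KMV2000.qhat q ^ Δ'⌋₊ / d₂ / s₂) (q ^ 2 / d₁ / t₁) (q ^ 2 / d₂ / t₂)
    (Y / (d₁ * t₁ * (d₂ * t₂))) hσ₁pos hσ₂pos hN hNM hMc hV _ _ hBsupp hsupp D₁ D₂ hD₁0 hD₂0 hD₁ hD₂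
  refine main.trans ?_
  -- the `ℓ²` sizes
  obtain ⟨hAs, hBs⟩ := sqrt_classCoeff_le h64 hB hΔ' i j hK0 (fun hN₁ hN₂ ↦ hK hN₁ hN₂) (q * r) Y hd₁ hd₂ hs₁ hs₂ ht₁ ht₂
  have hbr0 : 0 ≤ (Pascadi2025.bracket71 (s₁ * t₁ / g * ((⌊KMV2000.qhat q ^ Δ'⌋₊ / d₁ / s₁) * (⌊KMV2000.qhat q ^ Δ'⌋₊ / d₂ / s₂)) : ℕ) (s₂ * t₂ / g * (Y / (d₁ * t₁ * (d₂ * t₂))) : ℕ) ((q * r / g : ℕ) : ℝ) (r / g : ℕ) (r / g : ℕ)) ^ (1 / 6 : ℝ) := by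
    refine Real.rpow_nonneg ?_ _
    unfold Pascadi2025.bracket71
    positivity
  have hX0 : 0 ≤ C * Real.sqrt D₁ * Real.sqrt D₂ := by positivity
  have hB0 : 0 ≤ B := le_trans (abs_nonneg _) (hB 0 (by simp))
  refine mul_le_mul_of_nonneg_right (mul_le_mul_of_nonneg_right ?_ (Real.rpow_nonneg (Nat.cast_nonneg _) _)) hbr0
  exact mul_le_mul (mul_le_mul_of_nonneg_left hAs hX0) hBs (Real.sqrt_nonneg _) (by positivity)

/-- **The per-class bound, ordering `σ₂'V ≤ σ₁'Z₁Z₂ ≤ qr/g`** (CONDITIONAL on `pascadi2025_theorem71`; `q ≥ 64` prime, ANY `r`,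
class `(s₁,t₁,s₂,t₂)` with `q ∤ s₁ * t₁`, `g = ((s₁t₁,s₂t₂),qr)`; divisor bounds `D₁, D₂` as hypotheses).
[cite: Pascadi2025, Thm. 7.1 (case c = q·(r/g), a = 1)] -/
theorem norm_classForm_le_of_pascadi_all' (h : pascadi2025_theorem71) {ε : ℝ} (hε : 0 < ε) :
    ∃ C : ℝ, 0 ≤ C ∧ ∀ (q : ℕ) [NeZero q], 64 ≤ q → q.Prime → ∀ (r : ℕ),
      ∀ (P : ℝ[X]) (B : ℝ), (∀ t ∈ Set.Icc (0 : ℝ) 1, |P.eval t| ≤ B) → ∀ (Δ' : ℝ), 0 < Δ' →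
      ∀ (i j : ℕ) (K : ℝ), 0 ≤ K →
        (∀ {N₁ N₂ : ℕ}, N₁ ∈ afeBox q → N₂ ∈ afeBox q →
          ‖((((N₁ : ℝ) * N₂) ^ (-(1 / 2 : ℝ)) : ℝ) : ℂ) * afeW (KMV2000.qhat q) i j N₁ N₂‖ *
              Real.sqrt ((N₁ : ℝ) * N₂) ≤
            K * ((1 + Real.log (KMV2000.qhat q)) * (1 + 2 * Real.log q)) ^ (i + j) *
              (KMV2000.qhat q ^ 2 / ((N₁ : ℝ) * N₂)) ^ (0 : ℝ)) →
      ∀ (Y d₁ d₂ s₁ t₁ s₂ t₂ g : ℕ) [NeZero (q * r / g)],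
        1 ≤ d₁ → 1 ≤ d₂ → 1 ≤ s₁ → 1 ≤ s₂ → 1 ≤ t₁ → 1 ≤ t₂ →
        g = Nat.gcd (Nat.gcd (s₁ * t₁) (s₂ * t₂)) (q * r) → ¬ q ∣ s₁ * t₁ →
        1 ≤ s₁ * t₁ / g * ((⌊KMV2000.qhat q ^ Δ'⌋₊ / d₁ / s₁) * (⌊KMV2000.qhat q ^ Δ'⌋₊ / d₂ / s₂)) → s₁ * t₁ / g * ((⌊KMV2000.qhat q ^ Δ'⌋₊ / d₁ / s₁) * (⌊KMV2000.qhat q ^ Δ'⌋₊ / d₂ / s₂)) ≤ s₂ * t₂ / g * (Y / (d₁ * t₁ * (d₂ * t₂))) →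
        s₂ * t₂ / g * (Y / (d₁ * t₁ * (d₂ * t₂))) ≤ q * r / g →
        Y / (d₁ * t₁ * (d₂ * t₂)) ≤ (q ^ 2 / d₁ / t₁) * (q ^ 2 / d₂ / t₂) →
      ∀ (D₁ D₂ : ℝ), 0 ≤ D₁ → 0 ≤ D₂ →
        (∀ u ∈ Icc 1 ((⌊KMV2000.qhat q ^ Δ'⌋₊ / d₁ / s₁) * (⌊KMV2000.qhat q ^ Δ'⌋₊ / d₂ / s₂)), (#u.divisors : ℝ) ≤ D₁) →
        (∀ v ∈ Icc 1 ((q ^ 2 / d₁ / t₁) * (q ^ 2 / d₂ / t₂)), (#v.divisors : ℝ) ≤ D₂) →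
        ‖∑ f₁ ∈ Icc 1 (⌊KMV2000.qhat q ^ Δ'⌋₊ / d₁ / s₁), ∑ h₁ ∈ Icc 1 (q ^ 2 / d₁ / t₁),
          ∑ f₂ ∈ Icc 1 (⌊KMV2000.qhat q ^ Δ'⌋₊ / d₂ / s₂), ∑ h₂ ∈ Icc 1 (q ^ 2 / d₂ / t₂),
            (if Nat.Coprime f₁ (q * r) ∧ Nat.Coprime f₂ (q * r) then
                (KMV2000.mollifierCoeff P (KMV2000.qhat q ^ Δ') (d₁ * (s₁ * f₁)) : ℂ) *
                  (KMV2000.mollifierCoeff P (KMV2000.qhat q ^ Δ') (d₂ * (s₂ * f₂)) : ℂ) *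
                  ((Real.sqrt ((s₁ * f₁ : ℕ) : ℝ) * Real.sqrt ((s₂ * f₂ : ℕ) : ℝ) : ℝ) : ℂ) else 0) *
              (if Nat.Coprime h₁ (q * r) ∧ Nat.Coprime h₂ (q * r) then
                  (if d₁ * (t₁ * h₁) * (d₂ * (t₂ * h₂)) ≤ Y then
                      ((((((d₁ * (t₁ * h₁) : ℕ) : ℝ) * ((d₂ * (t₂ * h₂) : ℕ) : ℝ)) ^ (-(1 / 2 : ℝ)) : ℝ) : ℂ) *
                        afeW (KMV2000.qhat q) i j (d₁ * (t₁ * h₁)) (d₂ * (t₂ * h₂))) else 0) *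
                    ((Real.sqrt ((t₁ * h₁ : ℕ) : ℝ) * Real.sqrt ((t₂ * h₂ : ℕ) : ℝ) : ℝ) : ℂ) else 0) *
              kloostermanSum (q * r / g) ((s₁ * t₁ / g * (f₁ * f₂) : ℕ) : ZMod (q * r / g))
                ((s₂ * t₂ / g * (h₁ * h₂) : ℕ) : ZMod (q * r / g))‖ ≤
          C * Real.sqrt D₁ * Real.sqrt D₂ *
            (B ^ 2 * Real.sqrt (((⌊KMV2000.qhat q ^ Δ'⌋₊ / d₁ / s₁ : ℕ) : ℝ) * ((⌊KMV2000.qhat q ^ Δ'⌋₊ / d₂ / s₂ : ℕ) : ℝ))) *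
            (K * ((1 + Real.log (KMV2000.qhat q)) * (1 + 2 * Real.log q)) ^ (i + j) *
              Real.sqrt ((1 + 2 * Real.log q) * ((Y : ℝ) / (((d₁ * t₁ : ℕ) : ℝ) * ((d₂ * t₂ : ℕ) : ℝ))))) *
            ((q * r / g : ℕ) : ℝ) ^ (1 + ε) *
            (Pascadi2025.bracket71 (s₂ * t₂ / g * (Y / (d₁ * t₁ * (d₂ * t₂))) : ℕ) (s₁ * t₁ / g * ((⌊KMV2000.qhat q ^ Δ'⌋₊ / d₁ / s₁) * (⌊KMV2000.qhat q ^ Δ'⌋₊ / d₂ / s₂)) : ℕ) ((q * r / g : ℕ) : ℝ) (r / g : ℕ) (r / g : ℕ)) ^ (1 / 6 : ℝ) := by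
  obtain ⟨C, hC0, hC⟩ := norm_sum_four_le_of_pascadi_hyperbolic_all' h hε
  refine ⟨C, hC0, ?_⟩
  intro q _ h64 hq r P B hB Δ' hΔ' i j K hK0 hK Y d₁ d₂ s₁ t₁ s₂ t₂ g _ hd₁ hd₂ hs₁ hs₂ ht₁ ht₂ hg hσ
    hN hNM hMc hV D₁ D₂ hD₁0 hD₂0 hD₁ hD₂
  have hqr0 : q * r ≠ 0 := by
    intro h0
    exact NeZero.ne (q * r / g) (by rw [h0, Nat.zero_div])
  -- the class modulus `q r / g = q · (r/g)`, `q ∤ r/g`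
  obtain ⟨-, hcg⟩ := classGcd_dvd_right (r := r) (σ₂ := s₂ * t₂) hq hσ
  rw [← hg] at hcg
  -- the dilations are positive
  have hgpos : 0 < g := by rw [hg]; exact Nat.pos_of_ne_zero (Nat.gcd_ne_zero_right hqr0)
  have hgσ₁ : g ∣ s₁ * t₁ := by rw [hg]; exact (classGcd_dvd (s₁ * t₁) (s₂ * t₂) (q * r)).1
  have hgσ₂ : g ∣ s₂ * t₂ := by rw [hg]; exact (classGcd_dvd (s₁ * t₁) (s₂ * t₂) (q * r)).2.1
  have hσ₁pos : 0 < s₁ * t₁ / g :=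
    Nat.div_pos (Nat.le_of_dvd (Nat.mul_pos hs₁ ht₁) hgσ₁) hgpos
  have hσ₂pos : 0 < s₂ * t₂ / g :=
    Nat.div_pos (Nat.le_of_dvd (Nat.mul_pos hs₂ ht₂) hgσ₂) hgpos
  -- support and coprimality of the class coefficients
  have hD : 0 < d₁ * t₁ * (d₂ * t₂) := by positivity
  have hBsupp : ∀ n₁ n₂ : ℕ, Y / (d₁ * t₁ * (d₂ * t₂)) < n₁ * n₂ →
      (if Nat.Coprime n₁ (q * r) ∧ Nat.Coprime n₂ (q * r) then
          (if d₁ * (t₁ * n₁) * (d₂ * (t₂ * n₂)) ≤ Y then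
              ((((((d₁ * (t₁ * n₁) : ℕ) : ℝ) * ((d₂ * (t₂ * n₂) : ℕ) : ℝ)) ^ (-(1 / 2 : ℝ)) : ℝ) : ℂ) *
                afeW (KMV2000.qhat q) i j (d₁ * (t₁ * n₁)) (d₂ * (t₂ * n₂))) else 0) *
            ((Real.sqrt ((t₁ * n₁ : ℕ) : ℝ) * Real.sqrt ((t₂ * n₂ : ℕ) : ℝ) : ℝ) : ℂ) else 0) = 0 :=
    fun n₁ n₂ hlt ↦ classAFE_eq_zero_of_lt hD
      (fun N₁ N₂ ↦ ((((N₁ : ℝ) * (N₂ : ℝ)) ^ (-(1 / 2 : ℝ)) : ℝ) : ℂ) * afeW (KMV2000.qhat q) i j N₁ N₂)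
      (q * r) (fun n₁ n₂ ↦ ((Real.sqrt ((t₁ * n₁ : ℕ) : ℝ) * Real.sqrt ((t₂ * n₂ : ℕ) : ℝ) : ℝ) : ℂ)) hlt
  have hsupp : ∀ f₁ ∈ Icc 1 (⌊KMV2000.qhat q ^ Δ'⌋₊ / d₁ / s₁), ∀ f₂ ∈ Icc 1 (⌊KMV2000.qhat q ^ Δ'⌋₊ / d₂ / s₂),
      ∀ h₁ ∈ Icc 1 (q ^ 2 / d₁ / t₁), ∀ h₂ ∈ Icc 1 (q ^ 2 / d₂ / t₂),
      (if Nat.Coprime f₁ (q * r) ∧ Nat.Coprime f₂ (q * r) then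
          (KMV2000.mollifierCoeff P (KMV2000.qhat q ^ Δ') (d₁ * (s₁ * f₁)) : ℂ) *
            (KMV2000.mollifierCoeff P (KMV2000.qhat q ^ Δ') (d₂ * (s₂ * f₂)) : ℂ) *
            ((Real.sqrt ((s₁ * f₁ : ℕ) : ℝ) * Real.sqrt ((s₂ * f₂ : ℕ) : ℝ) : ℝ) : ℂ) else 0) *
        (if Nat.Coprime h₁ (q * r) ∧ Nat.Coprime h₂ (q * r) then
            (if d₁ * (t₁ * h₁) * (d₂ * (t₂ * h₂)) ≤ Y then
                ((((((d₁ * (t₁ * h₁) : ℕ) : ℝ) * ((d₂ * (t₂ * h₂) : ℕ) : ℝ)) ^ (-(1 / 2 : ℝ)) : ℝ) : ℂ) *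
                  afeW (KMV2000.qhat q) i j (d₁ * (t₁ * h₁)) (d₂ * (t₂ * h₂))) else 0) *
              ((Real.sqrt ((t₁ * h₁ : ℕ) : ℝ) * Real.sqrt ((t₂ * h₂ : ℕ) : ℝ) : ℝ) : ℂ) else 0) ≠ 0 →
      Nat.Coprime (Nat.gcd (s₁ * t₁ / g * (f₁ * f₂)) (s₂ * t₂ / g * (h₁ * h₂))) (q * r / g) := by
    intro f₁ _ f₂ _ h₁ _ h₂ _ hne
    have key := coprime_of_classCoeff_ne_zero hqr0 s₁ t₁ s₂ t₂
      (fun m₁ m₂ ↦ (KMV2000.mollifierCoeff P (KMV2000.qhat q ^ Δ') (d₁ * m₁) : ℂ) *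
        (KMV2000.mollifierCoeff P (KMV2000.qhat q ^ Δ') (d₂ * m₂) : ℂ) * ((Real.sqrt (m₁ : ℝ) * Real.sqrt (m₂ : ℝ) : ℝ) : ℂ))
      (fun n₁ n₂ ↦ (if d₁ * n₁ * (d₂ * n₂) ≤ Y then
          (((((((d₁ * n₁ : ℕ)) : ℝ) * ((d₂ * n₂ : ℕ) : ℝ)) ^ (-(1 / 2 : ℝ)) : ℝ) : ℂ) *
            afeW (KMV2000.qhat q) i j (d₁ * n₁) (d₂ * n₂)) else 0) *
          ((Real.sqrt (n₁ : ℝ) * Real.sqrt (n₂ : ℝ) : ℝ) : ℂ))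
      (f₁ := f₁) (h₁ := h₁) (f₂ := f₂) (h₂ := h₂) hne
    rw [← hg] at key
    exact key
  -- the per-class Pascadi inequality on the hyperbolic box
  have main := hC (q * r / g) q (r / g) hcg hq (s₁ * t₁ / g) (s₂ * t₂ / g)
    (⌊KMV2000.qhat q ^ Δ'⌋₊ / d₁ / s₁) (⌊KMV2000.qhat q ^ Δ'⌋₊ / d₂ / s₂) (q ^ 2 / d₁ / t₁) (q ^ 2 / d₂ / t₂)
    (Y / (d₁ * t₁ * (d₂ * t₂))) hσ₁pos hσ₂pos hN hNM hMc hV _ _ hBsupp hsupp D₁ D₂ hD₁0 hD₂0 hD₁ hD₂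
  refine main.trans ?_
  -- the `ℓ²` sizes
  obtain ⟨hAs, hBs⟩ := sqrt_classCoeff_le h64 hB hΔ' i j hK0 (fun hN₁ hN₂ ↦ hK hN₁ hN₂) (q * r) Y hd₁ hd₂ hs₁ hs₂ ht₁ ht₂
  have hbr0 : 0 ≤ (Pascadi2025.bracket71 (s₂ * t₂ / g * (Y / (d₁ * t₁ * (d₂ * t₂))) : ℕ) (s₁ * t₁ / g * ((⌊KMV2000.qhat q ^ Δ'⌋₊ / d₁ / s₁) * (⌊KMV2000.qhat q ^ Δ'⌋₊ / d₂ / s₂)) : ℕ) ((q * r / g : ℕ) : ℝ) (r / g : ℕ) (r / g : ℕ)) ^ (1 / 6 : ℝ) := by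
    refine Real.rpow_nonneg ?_ _
    unfold Pascadi2025.bracket71
    positivity
  have hX0 : 0 ≤ C * Real.sqrt D₁ * Real.sqrt D₂ := by positivity
  have hB0 : 0 ≤ B := le_trans (abs_nonneg _) (hB 0 (by simp))
  refine mul_le_mul_of_nonneg_right (mul_le_mul_of_nonneg_right ?_ (Real.rpow_nonneg (Nat.cast_nonneg _) _)) hbr0
  exact mul_le_mul (mul_le_mul_of_nonneg_left hAs hX0) hBs (Real.sqrt_nonneg _) (by positivity)

end Summit.Parity.GeneralizedHardyLittlewood.Theorems.MomentsBeyondDiagonal.Layers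

end
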